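import Literature.Analysis.FluidPDE.QuasiSelfSimilarMoveSP03Cert
import Literature.Analysis.FluidPDE.QuasiSelfSimilarMoveSC
import HarnessLib

/-!
# Straight move, phase 3: kernel checks (1/1)

Topic `Literature/Analysis/FluidPDE`. Emitted data / kernel certificates of the explicit straight generating
move (`S`) in the typed-chain model, under the contract of `PlanarGeneratorAssembly.lean`
(`acm_compatible_blocks_of_slots`). Generated by the author's emitter from the exact rational design;
no named facts, every theorem is decided in the kernel or assembled from decided chunks. [folklore]

## References

* G. Alberti, G. Crippa, A. L. Mazzucato, *Exponential self-similar mixing by incompressible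
  flows*, J. Amer. Math. Soc. 32 (2019), 445–490, §8 (arXiv:1605.02090).
-/

noncomputable section

namespace Literature.Analysis.FluidPDE.QuasiSelfSimilar.MoveS

open PlanarKinematics QuasiSelfSimilar

set_option maxHeartbeats 4000000 in
/-- Kernel check of element validity, nodes `0 ≤ k < 29`. [folklore] -/
theorem P03_valid_c0 : ∀ k, 0 ≤ k → k < 29 → (P03.node k).e.validB = true := by decide +kernel

set_option maxHeartbeats 4000000 in
/-- Kernel check of positivity, nodes `0 ≤ k < 29`. [folklore] -/
theorem P03_pos_c0 : ∀ k, 0 ≤ k → k < 29 → (decide (0 < (P03.node k).box.ρ) && decide (0 < (P03.node k).step.len)) = true := by decide +kernel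

set_option maxHeartbeats 4000000 in
/-- Kernel check of the node geometry (orders, pieces, cover tags), nodes `0 ≤ k < 29`. [folklore] -/
theorem P03_geo_c0 : ∀ k, 0 ≤ k → k < 29 → P03.geomAtB k = true := by decide +kernel

set_option maxHeartbeats 4000000 in
/-- Kernel check of box separation rows, nodes `0 ≤ k < 29`. [folklore] -/
theorem P03_sep_c0 : ∀ k, 0 ≤ k → k < 29 → P03.sepRowB k = true := by decide +kernel

set_option maxHeartbeats 4000000 in
/-- Kernel check of junction agreement, nodes `0 ≤ k < 29`. [folklore] -/
theorem P03_agr_c0 : ∀ k, 0 ≤ k → k < 29 → P03.agreeAtB k = true := by decide +kernel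

end Literature.Analysis.FluidPDE.QuasiSelfSimilar.MoveS

end
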